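import Literature.NumberTheory.Automorphic.SymplecticSimilitudeSphericalCharacters
import Literature.NumberTheory.Automorphic.SymplecticSimilitudeSatakeTp
import Literature.NumberTheory.Automorphic.SymplecticSimilitudeWeylInvariantPolynomials
import HarnessLib

/-!
# The Hecke algebra of `GSp_{2n}` is `R[t, ρ_0, …, ρ_{n-1}][ρ_0⁻¹]` via the Satake transform: `W(GSp_{2n})` = A–Z's `W_n`,
# `𝒮_q(ℋ) = R[x_0^{±1}, …, x_n^{±1}]^{W_n} = R[t, ρ][ρ_0⁻¹]`, `𝒮_q(T(p)) = q^{⟨ρ,1⟩} t`, `𝒮_q([ϖ]) = q^{⟨ρ,1⟩} ρ_0`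
# (Andrianov–Zhuravlev Thm. 3.30 (2)–(3), (3.51)–(3.57), (3.70), Lemma 3.34 — every rank, every `R` with `q ∈ Rˣ`)

Topic `NumberTheory/Automorphic`; namespace `Literature.NumberTheory.Automorphic.SymplecticCartan` (lane `lit-hodgefound`,
Track 2 foundations; seat `lit-hodgefound-p11`, generation 51, row g51-#9).  ONE DEFINITION with body (`similitudeSatakeAlgEquivAdjoin`,
the Satake isomorphism onto `R[t, ρ_0, …, ρ_{n-1}][ρ_0⁻¹]`) + theorems; no named fact, no instance, no notation.  The BRIDGE between
the generation-51 Satake files (`SymplecticSimilitudeSatakeWeylInvariance`: `similitudeSignedPermEquiv`, `similitudeWeylGroup`;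
`SymplecticSimilitudeSatakeIsomorphism`: `similitudeSatakeAlgEquiv`; `SymplecticSimilitudeSatakeTp`: `similitudeSatakeTransform_Tp`)
and the tree's Layer-A2 files `SymplecticSimilitudeWeylGroupInvariants` / `SymplecticSimilitudeWeylInvariantPolynomials`
(`SimilitudeWeyl.weylGroup` = A–Z's `W_n` generated by the permutations and the `τ_i` (3.51); `toLaurent`, `tPoly` (3.54), `rhoPoly`
(3.53), `gens` (3.55), `invariantPolynomials_eq_adjoin_gens` + `algebraicIndependent_gens` = Thm. 3.30 (2), `weylInvariants_weylGroup_eq_adjoin`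
= (3.57)).

## The mathematics

The two Weyl groups on the exponent lattice `ℤⁿ × ℤ` coincide: `w_{(1,π)}` is A–Z's permutation of `x_1, …, x_n`,
`w_{(ε^{(i)},1)}` (`ε^{(i)}_i = -1`, else `1`) is `τ_i : x_0 ↦ x_0x_i, x_i ↦ x_i⁻¹`, and `w_{(ε,π)} = (∏_{ε_i=-1} τ_i) ∘ π`
(`similitudeWeylGroup_eq_weylGroup`).  Hence, for every commutative ring `R` in which `q = #𝓀` is a unit
[cite: AndrianovZhuravlev1995, Ch. 3 §3.3 Thm. 3.30 (3), (3.57)] [cite: CartierCorvallis1979, §IV Thm. 4.1]: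

  **`𝒮_q : ℋ(GSp_{2n}(K), GSp_{2n}(𝒪); R) ⥲ R[x_0^{±1}, …, x_n^{±1}]^{W_n} = R[t, ρ_0, …, ρ_{n-1}][(x_0²x_1⋯x_n)⁻¹]`**
  (`range_similitudeSatakeTransform_eq_adjoin_gens`, `similitudeSatakeAlgEquivAdjoin`), so `ℋ_R` is GENERATED by the `n + 2`
  preimages of `t, ρ_0, …, ρ_{n-1}, ρ_0⁻¹` (`adjoin_preimage_gens_eq_top_similitude`; the first `n + 1` images are algebraically
  independent over `R` by `SimilitudeWeyl.algebraicIndependent_gens`, A–Z Thm. 3.30 (2) — compare the Cartan-generator presentation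
  `exists_algEquiv_heckeAlgebra_symplecticSimilitudeInt_localization` of `SymplecticSimilitudeHeckeAlgebraStructure`); the named images are
  **`𝒮_q(T(p)) = q^{⟨ρ,(1,…,1)⟩} · t`** (`⟨ρ,(1,…,1)⟩ = n(n+1)/2`; A–Z (3.70) «`Ω(T(p)) = t`», their `Ω` dividing out the
  `p`-power), i.e. `𝒮_q⁻¹(t) = q^{-⟨ρ,1⟩} T(p)` (`similitudeSatakeAlgEquiv_symm_tPoly`), **`𝒮_q(T_{ϖ·1}) = q^{⟨ρ,1⟩} · ρ_0`**
  (`ρ_0 = x_0²x_1⋯x_n`; A–Z Lemma 3.34 «`Ω(Δ_n(p)) = p^{-⟨n⟩} x_0²x_1⋯x_n`») and **`𝒮_q(T_{(ϖ·1)⁻¹}) = q^{-⟨ρ,1⟩} · ρ_0⁻¹`**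
  (the element adjoined in (3.57) is the image of the inverse of the central generator `[ϖ]`).

## What is formalised

* §1 `similitudeSignedPermEquiv_one_left` (`= permLattice π`), `similitudeSignedPermEquiv_update_neg_one` (`= tauLattice i`),
  `similitudeSignedPermEquiv_sign_mem_weylGroup`, **`similitudeWeylGroup_eq_weylGroup`**, `weylInvariants_similitudeWeylGroup_eq_adjoin`
  ((3.57) for `W(GSp_{2n})`), `toLaurent_mem_weylInvariants_similitudeWeylGroup_iff`.
* §2 **`range_similitudeSatakeTransform_eq_adjoin_gens`**, **`similitudeSatakeAlgEquivAdjoin`**, `coe_similitudeSatakeAlgEquivAdjoin`,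
  **`adjoin_preimage_gens_eq_top_similitude`** (`ℋ = R[𝒮⁻¹t, 𝒮⁻¹ρ_a, 𝒮⁻¹ρ_0⁻¹]`).
* §3 **`similitudeSatakeTransform_Tp_eq_smul_toLaurent_tPoly`**, `similitudeSatakeAlgEquiv_symm_tPoly`,
  **`similitudeSatakeTransform_center_eq_smul_toLaurent_rhoPoly_zero`**, **`similitudeSatakeTransform_centerInv_eq_smul_rhoZeroInv`**.

## References
* [AndrianovZhuravlev1995] A. N. Andrianov, V. G. Zhuravlev, *Modular Forms and Hecke Operators* (1995), Ch. 3 §3.3 (3.51)–(3.57),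
  Thm. 3.30, Lemma 3.34, (3.70) (held text `book:andrianov2015-modular-forms-hecke-operators`, pp. 148–157).
* [CartierCorvallis1979] P. Cartier, *Representations of 𝔭-adic groups: a survey*, PSPM 33.1 (1979), §IV (4.2), Thm. 4.1.
* [Satake1963] I. Satake, *Theory of spherical functions on reductive algebraic groups over 𝔭-adic fields*, Publ. Math. IHÉS 18
  (1963), §7 (the case `GSp`), §8.
-/

noncomputable section

open scoped Valued WithZero MatrixGroups
open MonoidAlgebra Representation

namespace Literature.NumberTheory.Automorphic.SymplecticCartan

open Literature.NumberTheory.Automorphic Literature.NumberTheory.Automorphic.CartanUnique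

variable {n : ℕ}

/-! ## §1 `W(GSp_{2n})` is Andrianov–Zhuravlev's `W_n` -/

/-- **`w_{(1,π)}` is A–Z's permutation of `x_1, …, x_n`** on exponents: `(μ, c) ↦ (μ ∘ π, c)`.
[cite: AndrianovZhuravlev1995, Ch. 3 §3.3 (3.51)] -/
theorem similitudeSignedPermEquiv_one_left (π : Equiv.Perm (Fin n)) :
    similitudeSignedPermEquiv 1 π = SimilitudeWeyl.permLattice π :=
  LinearEquiv.ext fun x => by
    rw [similitudeSignedPermEquiv_apply, SimilitudeWeyl.permLattice_apply]
    refine Prod.ext (funext fun i => ?_) rfl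
    dsimp only
    rw [Pi.one_apply, if_pos rfl]

/-- **`w_{(ε^{(i)},1)}` with `ε^{(i)}_i = -1`, `ε^{(i)}_j = 1` (`j ≠ i`) is A–Z's `τ_i`** (`x_0 ↦ x_0x_i`, `x_i ↦ x_i⁻¹`):
`(μ, c) ↦ (μ with μ_i ↦ c - μ_i, c)`. [cite: AndrianovZhuravlev1995, Ch. 3 §3.3 (3.51)] -/
theorem similitudeSignedPermEquiv_update_neg_one (i : Fin n) :
    similitudeSignedPermEquiv (Function.update 1 i (-1)) 1 = SimilitudeWeyl.tauLattice i :=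
  LinearEquiv.ext fun x => by
    rw [similitudeSignedPermEquiv_apply, SimilitudeWeyl.tauLattice_apply]
    refine Prod.ext (funext fun j => ?_) rfl
    dsimp only
    by_cases h : j = i
    · subst h
      rw [Function.update_self, if_neg (by decide), if_pos rfl, Equiv.Perm.one_apply]
    · rw [Function.update_of_ne h, Pi.one_apply, if_pos rfl, if_neg h, Equiv.Perm.one_apply]

/-- **A pure sign change `w_{(ε,1)}` is the product of the `τ_i` over `ε_i = -1`**, hence lies in `W_n`.
[cite: AndrianovZhuravlev1995, Ch. 3 §3.3 (3.51)] -/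
theorem similitudeSignedPermEquiv_sign_mem_weylGroup (ε : Fin n → ℤˣ) :
    similitudeSignedPermEquiv ε 1 ∈ SimilitudeWeyl.weylGroup n := by
  classical
  suffices h : ∀ s : Finset (Fin n),
      similitudeSignedPermEquiv (fun i => if i ∈ s then ε i else 1) 1 ∈ SimilitudeWeyl.weylGroup n by
    have hε : ε = fun i => if i ∈ (Finset.univ : Finset (Fin n)) then ε i else 1 := funext fun i => by
      rw [if_pos (Finset.mem_univ i)]
    rw [hε]
    exact h Finset.univ
  intro s
  induction s using Finset.induction_on with
  | empty =>
    have h1 : (fun i : Fin n => if i ∈ (∅ : Finset (Fin n)) then ε i else 1) = fun _ => (1 : ℤˣ) :=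
      funext fun i => if_neg (Finset.notMem_empty i)
    rw [h1, similitudeSignedPermEquiv_one]
    exact one_mem _
  | insert a s ha ih =>
    have hmul : similitudeSignedPermEquiv (fun i => if i ∈ insert a s then ε i else 1) (1 : Equiv.Perm (Fin n)) =
        similitudeSignedPermEquiv (Function.update 1 a (ε a)) 1 *
          similitudeSignedPermEquiv (fun i => if i ∈ s then ε i else 1) 1 := by
      rw [similitudeSignedPermEquiv_mul, mul_one]
      congr 1
      funext i
      rw [Equiv.Perm.one_apply]
      by_cases hi : i = a
      · subst hi
        rw [Function.update_self, if_pos (Finset.mem_insert_self _ _), if_neg ha, mul_one]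
      · rw [Function.update_of_ne hi, Pi.one_apply, one_mul]
        by_cases his : i ∈ s
        · rw [if_pos his, if_pos (Finset.mem_insert_of_mem his)]
        · rw [if_neg his, if_neg (fun h => (Finset.mem_insert.1 h).elim hi his)]
    rw [hmul]
    refine mul_mem ?_ ih
    rcases Int.units_eq_one_or (ε a) with h1 | h1
    · have hupd : Function.update (1 : Fin n → ℤˣ) a (ε a) = fun _ => 1 := funext fun i => by
        by_cases hi : i = a
        · subst hi
          rw [Function.update_self, h1]
        · rw [Function.update_of_ne hi, Pi.one_apply]
      rw [hupd, similitudeSignedPermEquiv_one]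
      exact one_mem _
    · rw [h1, similitudeSignedPermEquiv_update_neg_one]
      exact SimilitudeWeyl.tauLattice_mem_weylGroup a

/-- **`W(GSp_{2n}) = W_n`**: the subgroup of `Aut_ℤ(ℤⁿ × ℤ)` generated by the `w_{(ε,π)}` of `similitudeWeylGroup` is
Andrianov–Zhuravlev's `W_n` generated by the permutations of `x_1, …, x_n` and the `τ_i` (`SimilitudeWeyl.weylGroup`).
[cite: AndrianovZhuravlev1995, Ch. 3 §3.3 (3.51)] [cite: CartierCorvallis1979, §IV (4.2)] -/
theorem similitudeWeylGroup_eq_weylGroup (n : ℕ) : similitudeWeylGroup n = SimilitudeWeyl.weylGroup n := by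
  refine le_antisymm (fun w hw => ?_) ?_
  · obtain ⟨ε, π, rfl⟩ := (mem_similitudeWeylGroup_iff w).1 hw
    have hsplit : similitudeSignedPermEquiv ε π = similitudeSignedPermEquiv ε 1 * similitudeSignedPermEquiv 1 π := by
      rw [similitudeSignedPermEquiv_mul, mul_one]
      congr 1
      funext i
      rw [Pi.one_apply, mul_one]
    rw [hsplit]
    refine mul_mem (similitudeSignedPermEquiv_sign_mem_weylGroup ε) ?_
    rw [similitudeSignedPermEquiv_one_left]
    exact SimilitudeWeyl.permLattice_mem_weylGroup π
  · change Subgroup.closure _ ≤ _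
    refine (Subgroup.closure_le _).2 ?_
    rintro w (⟨π, rfl⟩ | ⟨i, rfl⟩)
    · rw [SetLike.mem_coe, ← similitudeSignedPermEquiv_one_left]
      exact similitudeSignedPermEquiv_mem_similitudeWeylGroup 1 π
    · rw [SetLike.mem_coe, ← similitudeSignedPermEquiv_update_neg_one]
      exact similitudeSignedPermEquiv_mem_similitudeWeylGroup _ 1

variable {R : Type*} [CommRing R]

/-- **(3.57) for `W(GSp_{2n})`**: `R[x_0^{±1}, …, x_n^{±1}]^{W(GSp_{2n})} = R[t, ρ_0, …, ρ_{n-1}][(x_0²x_1⋯x_n)⁻¹]`, the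
subalgebra generated by `toLaurent t`, `toLaurent ρ_a` (`a < n`) and `ρ_0⁻¹`. [cite: AndrianovZhuravlev1995, Ch. 3 §3.3 Thm. 3.30 (3), (3.57)] -/
theorem weylInvariants_similitudeWeylGroup_eq_adjoin (n : ℕ) :
    weylInvariants R ((Fin n → ℤ) × ℤ) (similitudeWeylGroup n) =
      Algebra.adjoin R (insert (SimilitudeWeyl.rhoZeroInv n)
        (SimilitudeWeyl.toLaurent '' Set.range (SimilitudeWeyl.gens R n))) := by
  rw [similitudeWeylGroup_eq_weylGroup, SimilitudeWeyl.weylInvariants_weylGroup_eq_adjoin]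

/-- **Invariant POLYNOMIALS**: a polynomial `F ∈ R[x_0, …, x_n]` is `W(GSp_{2n})`-invariant in the Laurent ring iff it lies in A–Z's
`R[x_0, …, x_n]_W = R[t, ρ_0, …, ρ_{n-1}]`. [cite: AndrianovZhuravlev1995, Ch. 3 §3.3 Thm. 3.30 (2), (3.56)] -/
theorem toLaurent_mem_weylInvariants_similitudeWeylGroup_iff (F : MvPolynomial (Option (Fin n)) R) :
    SimilitudeWeyl.toLaurent F ∈ weylInvariants R ((Fin n → ℤ) × ℤ) (similitudeWeylGroup n) ↔
      F ∈ Algebra.adjoin R (Set.range (SimilitudeWeyl.gens R n)) := by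
  rw [similitudeWeylGroup_eq_weylGroup, ← SimilitudeWeyl.mem_invariantPolynomials_iff, SimilitudeWeyl.invariantPolynomials_eq_adjoin_gens]

/-! ## §2 `𝒮_q : ℋ(GSp_{2n}(K), GSp_{2n}(𝒪); R) ⥲ R[t, ρ_0, …, ρ_{n-1}][ρ_0⁻¹]` -/

section Hecke

variable {K : Type*} [Field K] [Valued K ℤᵐ⁰] {ϖ : K} [NeZero n] [CompactSpace 𝒪[K]] [Finite 𝓀[K]]
  [IsHeckeTriple (⊤ : Submonoid (symplecticSimilitudeGroup (Fin n) K)) (symplecticSimilitudeInt (Fin n) K)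
    (symplecticSimilitudeInt (Fin n) K)]

/-- **THM. 3.30 (3) WITH (3.57): `𝒮_q(ℋ(GSp_{2n}(K), GSp_{2n}(𝒪); R)) = R[t, ρ_0, …, ρ_{n-1}][(x_0²x_1⋯x_n)⁻¹]`** for every
commutative ring `R` with `(q : R) = #𝓀` a unit. [cite: AndrianovZhuravlev1995, Ch. 3 §3.3 Thm. 3.30 (3), (3.57)]
[cite: CartierCorvallis1979, §IV Thm. 4.1] -/
theorem range_similitudeSatakeTransform_eq_adjoin_gens (hϖ : Valued.v ϖ = WithZero.exp (-1 : ℤ)) (q : Rˣ)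
    (hq : (q : R) = Nat.card 𝓀[K]) :
    (similitudeSatakeTransform (n := n) (K := K) hϖ q).range =
      Algebra.adjoin R (insert (SimilitudeWeyl.rhoZeroInv n)
        (SimilitudeWeyl.toLaurent '' Set.range (SimilitudeWeyl.gens R n))) := by
  rw [range_similitudeSatakeTransform_eq_weylInvariants hϖ q hq, weylInvariants_similitudeWeylGroup_eq_adjoin]

/-- **THE SATAKE ISOMORPHISM OF `GSp_{2n}` ONTO `R[t, ρ_0, …, ρ_{n-1}][ρ_0⁻¹]`** (A–Z Thm. 3.30 (2)–(3) combined):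
`𝒮_q : ℋ_R ⥲ R[toLaurent t, toLaurent ρ_a, ρ_0⁻¹]`. [cite: AndrianovZhuravlev1995, Ch. 3 §3.3 Thm. 3.30 (3), (3.57)]
[cite: CartierCorvallis1979, §IV Thm. 4.1] -/
def similitudeSatakeAlgEquivAdjoin (hϖ : Valued.v ϖ = WithZero.exp (-1 : ℤ)) (q : Rˣ) (hq : (q : R) = Nat.card 𝓀[K]) :
    heckeAlgebra R (symplecticSimilitudeGroup (Fin n) K) (symplecticSimilitudeInt (Fin n) K) ≃ₐ[R]
      Algebra.adjoin R (insert (SimilitudeWeyl.rhoZeroInv n)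
        (SimilitudeWeyl.toLaurent '' Set.range (SimilitudeWeyl.gens R n))) :=
  (similitudeSatakeAlgEquiv hϖ q hq).trans (Subalgebra.equivOfEq _ _ (weylInvariants_similitudeWeylGroup_eq_adjoin n))

/-- `similitudeSatakeAlgEquivAdjoin` is `𝒮_q`. [cite: AndrianovZhuravlev1995, Ch. 3 §3.3 Thm. 3.30 (3)] -/
theorem coe_similitudeSatakeAlgEquivAdjoin (hϖ : Valued.v ϖ = WithZero.exp (-1 : ℤ)) (q : Rˣ) (hq : (q : R) = Nat.card 𝓀[K])
    (T : heckeAlgebra R (symplecticSimilitudeGroup (Fin n) K) (symplecticSimilitudeInt (Fin n) K)) :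
    ((similitudeSatakeAlgEquivAdjoin hϖ q hq T : Algebra.adjoin R (insert (SimilitudeWeyl.rhoZeroInv n)
        (SimilitudeWeyl.toLaurent '' Set.range (SimilitudeWeyl.gens R n)))) : AddMonoidAlgebra R ((Fin n → ℤ) × ℤ)) =
      similitudeSatakeTransform hϖ q T := rfl

/-- **`ℋ_R` IS GENERATED BY THE `n + 2` PREIMAGES OF `t, ρ_0, …, ρ_{n-1}, ρ_0⁻¹`** (A–Z: «`T(p), T_1(p²), …, T_n(p²)` generate the
ring `L̲^n_p`», and `L^n_p = L̲^n_p[Δ⁻¹]`, transported through Thm. 3.30 (3)). [cite: AndrianovZhuravlev1995, Ch. 3 §3.3 Thm. 3.30, (3.57)] -/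
theorem adjoin_preimage_gens_eq_top_similitude (hϖ : Valued.v ϖ = WithZero.exp (-1 : ℤ)) (q : Rˣ) (hq : (q : R) = Nat.card 𝓀[K]) :
    Algebra.adjoin R {T : heckeAlgebra R (symplecticSimilitudeGroup (Fin n) K) (symplecticSimilitudeInt (Fin n) K) |
      similitudeSatakeTransform hϖ q T ∈ insert (SimilitudeWeyl.rhoZeroInv n)
        (SimilitudeWeyl.toLaurent '' Set.range (SimilitudeWeyl.gens R n))} = ⊤ := by
  set S : Set (AddMonoidAlgebra R ((Fin n → ℤ) × ℤ)) := insert (SimilitudeWeyl.rhoZeroInv n)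
    (SimilitudeWeyl.toLaurent '' Set.range (SimilitudeWeyl.gens R n)) with hS
  refine Algebra.eq_top_iff.2 fun T => ?_
  have hrange := range_similitudeSatakeTransform_eq_adjoin_gens (n := n) (K := K) hϖ q hq
  have hsub : S ⊆ Set.range (similitudeSatakeTransform (n := n) (K := K) hϖ q) := by
    rw [← AlgHom.coe_range, hrange]
    exact Algebra.subset_adjoin
  have himage : similitudeSatakeTransform hϖ q '' (similitudeSatakeTransform (n := n) (K := K) hϖ q ⁻¹' S) = S :=
    Set.image_preimage_eq_of_subset hsub
  have hT : similitudeSatakeTransform hϖ q T ∈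
      (Algebra.adjoin R (similitudeSatakeTransform (n := n) (K := K) hϖ q ⁻¹' S)).map (similitudeSatakeTransform hϖ q) := by
    rw [AlgHom.map_adjoin, himage, ← hrange]
    exact ⟨T, rfl⟩
  obtain ⟨T', hT', hTT'⟩ := Subalgebra.mem_map.1 hT
  rw [← similitudeSatakeTransform_injective_of_commRing hϖ q hTT']
  exact hT'

end Hecke

/-! ## §3 `T(p) ↦ q^{⟨ρ,1⟩} t`, `[ϖ] ↦ q^{⟨ρ,1⟩} ρ_0`, `[ϖ]⁻¹ ↦ q^{-⟨ρ,1⟩} ρ_0⁻¹` -/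

section Named

variable {K : Type*} [Field K] [Valued K ℤᵐ⁰] {ϖ : K} [NeZero n] [CompactSpace 𝒪[K]] [Finite 𝓀[K]]
  [IsHeckeTriple (⊤ : Submonoid (symplecticSimilitudeGroup (Fin n) K)) (symplecticSimilitudeInt (Fin n) K)
    (symplecticSimilitudeInt (Fin n) K)]

/-- **`𝒮_q(T(p)) = q^{⟨ρ,(1,…,1)⟩} · t`**, `t = x_0 ∏ (1 + x_i)` A–Z's generator (3.54) (their (3.70) «`Ω(T(p)) = t`», `Ω` divided
by the `p`-power). [cite: AndrianovZhuravlev1995, Ch. 3 §3.3 (3.54), (3.70)] -/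
theorem similitudeSatakeTransform_Tp_eq_smul_toLaurent_tPoly (hϖ : Valued.v ϖ = WithZero.exp (-1 : ℤ)) (q : Rˣ)
    (hq : (q : R) = Nat.card 𝓀[K]) :
    similitudeSatakeTransform hϖ q (heckeAlgebra.doubleCosetOperator (symplecticSimilitudeInt (Fin n) K)
      (similitudeTorusElt (uniformizer_ne_zero hϖ) 1 (0 : Fin n → ℤ) : symplecticSimilitudeGroup (Fin n) K)) =
      (((q ^ symplecticRhoPairing (fun _ : Fin n => (1 : ℤ)) : Rˣ) : R)) • SimilitudeWeyl.toLaurent (SimilitudeWeyl.tPoly R n) := by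
  rw [similitudeSatakeTransform_Tp hϖ q hq, SimilitudeWeyl.toLaurent_tPoly, ← smul_mul_assoc]
  simp only [SimilitudeWeyl.lx0, SimilitudeWeyl.lx]
  rw [AddMonoidAlgebra.smul_single', mul_one]

/-- **`𝒮_q⁻¹(t) = q^{-⟨ρ,1⟩} · T(p)`**: A–Z's (3.70) «`Ω(T(p)) = t`» as a statement about the inverse Satake isomorphism.
[cite: AndrianovZhuravlev1995, Ch. 3 §3.3 (3.70), Thm. 3.30 (3)] -/
theorem similitudeSatakeAlgEquiv_symm_tPoly (hϖ : Valued.v ϖ = WithZero.exp (-1 : ℤ)) (q : Rˣ) (hq : (q : R) = Nat.card 𝓀[K]) :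
    (similitudeSatakeAlgEquiv hϖ q hq).symm ⟨SimilitudeWeyl.toLaurent (SimilitudeWeyl.tPoly R n),
        (toLaurent_mem_weylInvariants_similitudeWeylGroup_iff _).2
          (Algebra.subset_adjoin ⟨Fin.last n, SimilitudeWeyl.gens_last⟩)⟩ =
      ((((q ^ symplecticRhoPairing (fun _ : Fin n => (1 : ℤ)))⁻¹ : Rˣ) : R)) •
        heckeAlgebra.doubleCosetOperator (symplecticSimilitudeInt (Fin n) K)
          (similitudeTorusElt (uniformizer_ne_zero hϖ) 1 (0 : Fin n → ℤ) : symplecticSimilitudeGroup (Fin n) K) := by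
  rw [AlgEquiv.symm_apply_eq]
  refine Subtype.ext ?_
  rw [map_smul, Subalgebra.coe_smul, coe_similitudeSatakeAlgEquiv, similitudeSatakeTransform_Tp_eq_smul_toLaurent_tPoly hϖ q hq,
    smul_smul, Units.inv_mul, one_smul]

end Named

section Central

variable {K : Type*} [Field K] [Valued K ℤᵐ⁰] {ϖ : K} [NeZero n]
  [IsHeckeTriple (⊤ : Submonoid (symplecticSimilitudeGroup (Fin n) K)) (symplecticSimilitudeInt (Fin n) K)
    (symplecticSimilitudeInt (Fin n) K)]

/-- **`𝒮_q(T_{ϖ·1}) = q^{⟨ρ,(1,…,1)⟩} · ρ_0`**, `ρ_0 = x_0²x_1⋯x_n` (`[ϖ] = T_{t(2,-1)}` the central generator; A–Z Lemma 3.34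
«`Ω(Δ_n(p)) = p^{-⟨n⟩} x_0²x_1⋯x_n`»). [cite: AndrianovZhuravlev1995, Ch. 3 §3.3 Lemma 3.34, (3.53)] -/
theorem similitudeSatakeTransform_center_eq_smul_toLaurent_rhoPoly_zero (hϖ : Valued.v ϖ = WithZero.exp (-1 : ℤ)) (q : Rˣ) :
    similitudeSatakeTransform hϖ q (heckeAlgebra.doubleCosetOperator (symplecticSimilitudeInt (Fin n) K)
      (similitudeTorusElt (uniformizer_ne_zero hϖ) 2 (fun _ : Fin n => -1) : symplecticSimilitudeGroup (Fin n) K)) =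
      (((q ^ symplecticRhoPairing (fun _ : Fin n => (1 : ℤ)) : Rˣ) : R)) • SimilitudeWeyl.toLaurent (SimilitudeWeyl.rhoPoly R n 0) := by
  have h := similitudeSatakeTransform_doubleCosetOperator_central (n := n) (K := K) hϖ q 1
  simp only [mul_one] at h
  rw [h, SimilitudeWeyl.toLaurent_rhoPoly_zero, AddMonoidAlgebra.smul_single', mul_one]

/-- **`𝒮_q(T_{(ϖ·1)⁻¹}) = q^{-⟨ρ,(1,…,1)⟩} · ρ_0⁻¹`**: the element `(x_0²x_1⋯x_n)⁻¹` adjoined in (3.57) is, up to the unit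
`q^{⟨ρ,1⟩}`, the image of the inverse `T_{t(-2,1)}` of the central generator. [cite: AndrianovZhuravlev1995, Ch. 3 §3.3 (3.57), Lemma 3.34] -/
theorem similitudeSatakeTransform_centerInv_eq_smul_rhoZeroInv (hϖ : Valued.v ϖ = WithZero.exp (-1 : ℤ)) (q : Rˣ) :
    similitudeSatakeTransform hϖ q (heckeAlgebra.doubleCosetOperator (symplecticSimilitudeInt (Fin n) K)
      (similitudeTorusElt (uniformizer_ne_zero hϖ) (-2) (fun _ : Fin n => 1) : symplecticSimilitudeGroup (Fin n) K)) =
      ((((q ^ symplecticRhoPairing (fun _ : Fin n => (1 : ℤ)))⁻¹ : Rˣ) : R)) • (SimilitudeWeyl.rhoZeroInv n) := by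
  have h := similitudeSatakeTransform_doubleCosetOperator_central (n := n) (K := K) hϖ q (-1)
  simp only [mul_neg, mul_one, neg_neg] at h
  have hρ : symplecticRhoPairing (fun _ : Fin n => (-1 : ℤ)) = -symplecticRhoPairing (fun _ : Fin n => (1 : ℤ)) := by
    rw [show (fun _ : Fin n => (-1 : ℤ)) = -fun _ : Fin n => (1 : ℤ) from rfl]
    exact (symplecticRhoPairingHom n).map_neg _
  rw [h, SimilitudeWeyl.rhoZeroInv, AddMonoidAlgebra.smul_single', mul_one, hρ, zpow_neg]

end Central

end Literature.NumberTheory.Automorphic.SymplecticCartan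

end
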